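import Mathlib

/-!
# SoloBlind artefact 30 — LEMMA Ψ* is a comb identity (`paper/window-height.md` §12.10.3 (i″); claims C114, C73/C74)

Context (soloist `solo-RiemannHypothesis-blind`, session s37).  THEOREM K of the report (`∫₀^{2π}|T′| ≤ (2n/π)∫₀^{2π}T`
for every nonnegative trigonometric polynomial `T` of degree `≤ n`, sharp at `1 + cos nθ`) ends with
LEMMA Ψ*: at a GLOBAL maximum `ω*` of a real trigonometric polynomial `T` of degree `≤ n`,
`T″(ω*) + n·(T̃)′(ω*) ≥ 0`, where `T̃` is the conjugate polynomial (`cos ↦ sin`, `sin ↦ −cos`).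
Artefact 20 (`SoloBlindFejerArgSpeed`) kernel-checked only the finitary core of the s16 proof (Abel summation + Fejér's
bound under a Fejér–Riesz interface); the analytic shell (division by `sin²(s/2)`, the conjugate-function integral,
Fejér–Riesz) stayed prose.  THIS FILE MAKES LEMMA Ψ* ITSELF A KERNEL THEOREM, with no interface hypotheses, through an
exact identity of M. Riesz interpolation type found in s37:

  for `T(x) = Σ_{m=0}^{n} (a_m cos(mx) + b_m sin(mx))`:
  `Σ_{m=0}^{n} (n·m − m²)·a_m  =  Σ_{k=1}^{n−1} (T(0) − T(2πk/n)) / (1 − cos(2πk/n))`            (COMB IDENTITY)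

The left side is `T″(0) + n·(T̃)′(0)` (the Fourier multiplier `n|m| − m²`; see `soloBlind_trigPoly_second_deriv` and
`soloBlind_conjPoly_deriv` below, which compute `T″(0) = −Σ m² a_m` and `(T̃)′(0) = Σ m a_m`).  Every weight
`1/(1 − cos(2πk/n)) = 1/(2 sin²(πk/n))` is positive, so at a global maximum each summand on the right is `≥ 0`:
LEMMA Ψ* follows at once (`soloBlind_psiStar_nonneg`), with equality iff `T(2πk/n) = T(0)` for all `k`, i.e. iff
`max T − T ∝ 1 − cos(n(θ − ω*))` — the equality case of THEOREM K.  Behind the identity: on `[−n, n]` the multiplier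
`n|m| − m²` is the function `d(n − d)` of `d = |m| mod n`, i.e. `n ×` the effective resistance between two points of the
`n`-cycle, whose spectral expansion is the Fejér-kernel identity `Σ_{k=1}^{n−1} sin²(πkd/n)/sin²(πk/n) = d(n − d)`
(`soloBlind_comb_cos_sum`, proved here by the second-difference recursion `S(d+1) − 2S(d) + S(d−1) = 2Σ_{k=1}^{n−1}cos(2πkd/n) = −2`).
Mathlib only; no sorries; no new definitions (the polynomials enter through hypotheses `hT`, `hTc`, …).
-/

open Finset Real

namespace Summit.RiemannHypothesis.RiemannHypothesis.Theorems

/-- Lagrange's identity in telescoped form: `2 sin(x/2) Σ_{k<n} cos(kx) = sin((n − 1/2)x) + sin(x/2)`. -/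
theorem soloBlind_two_sin_half_mul_sum_cos (x : ℝ) (n : ℕ) :
    2 * sin (x / 2) * ∑ k ∈ range n, cos (k * x) = sin ((n - 1 / 2) * x) + sin (x / 2) := by
  have key : ∀ k : ℕ, 2 * sin (x / 2) * cos (k * x)
      = sin (((k : ℝ) + 1 - 1 / 2) * x) - sin (((k : ℝ) - 1 / 2) * x) := by
    intro k
    have h1 : ((k : ℝ) + 1 - 1 / 2) * x = k * x + x / 2 := by ring
    have h2 : ((k : ℝ) - 1 / 2) * x = k * x - x / 2 := by ring
    rw [h1, h2, sin_add, sin_sub]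
    ring
  rw [mul_sum]
  simp_rw [key]
  have tel := Finset.sum_range_sub (fun k : ℕ => sin (((k : ℝ) - 1 / 2) * x)) n
  simp only [Nat.cast_add, Nat.cast_one] at tel
  rw [tel]
  have h3 : (((0 : ℕ) : ℝ) - 1 / 2) * x = -(x / 2) := by push_cast; ring
  rw [h3, sin_neg]
  ring

/-- Orthogonality of the comb: `Σ_{k<n} cos(2πkm/n) = 0` whenever `n ∤ m`. -/
theorem soloBlind_sum_cos_comb_eq_zero (n m : ℕ) (hn : 0 < n) (hm : ¬ n ∣ m) :
    ∑ k ∈ range n, cos (2 * π * k * m / n) = 0 := by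
  have hn' : (n : ℝ) ≠ 0 := by exact_mod_cast hn.ne'
  set x : ℝ := 2 * π * m / n with hx
  have hsum : ∑ k ∈ range n, cos (2 * π * k * m / n) = ∑ k ∈ range n, cos (k * x) := by
    refine sum_congr rfl fun k _ => ?_
    congr 1; rw [hx]; ring
  rw [hsum]
  have hsin : sin (x / 2) ≠ 0 := by
    intro h0
    rw [sin_eq_zero_iff] at h0
    obtain ⟨j, hj⟩ := h0
    apply hm
    have hj' : (j : ℝ) * n = m := by
      have h0 : (j : ℝ) * π = π * m / n := by rw [hj, hx]; ring
      have h1 : (j : ℝ) * π * n = π * m := by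
        rw [h0]; field_simp
      have h2 : π * ((j : ℝ) * n) = π * m := by rw [← h1]; ring
      exact mul_left_cancel₀ pi_pos.ne' h2
    have hjz : (j : ℤ) * n = m := by exact_mod_cast hj'
    have : (n : ℤ) ∣ (m : ℤ) := ⟨j, by rw [← hjz]; ring⟩
    exact Int.natCast_dvd_natCast.mp this
  have hL := soloBlind_two_sin_half_mul_sum_cos x n
  have hper : sin ((n - 1 / 2) * x) = -sin (x / 2) := by
    have : (n - 1 / 2) * x = -(x / 2) + (m : ℕ) * (2 * π) := by
      rw [hx]; field_simp; ring
    rw [this, sin_add_nat_mul_two_pi, sin_neg]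
  rw [hper] at hL
  have : 2 * sin (x / 2) * ∑ k ∈ range n, cos (k * x) = 0 := by linarith
  rcases mul_eq_zero.mp this with h | h
  · exfalso; exact hsin (by linarith)
  · exact h

/-- For `1 ≤ k ≤ n − 1` the comb weight is well defined: `1 − cos(2πk/n) ≠ 0` (indeed `> 0`). -/
theorem soloBlind_one_sub_cos_comb_pos (n k : ℕ) (hk1 : 1 ≤ k) (hkn : k < n) :
    0 < 1 - cos (2 * π * k / n) := by
  have hn : (0 : ℝ) < n := by exact_mod_cast (lt_of_le_of_lt (Nat.zero_le _) hkn)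
  have hlt : cos (2 * π * k / n) < 1 := by
    have hne : cos (2 * π * k / n) ≠ 1 := by
      intro h1
      rw [cos_eq_one_iff] at h1
      obtain ⟨j, hj⟩ := h1
      have hj' : (j : ℝ) * n = k := by
        have h1 : (j : ℝ) * (2 * π) * n = 2 * π * k := by
          rw [hj]; field_simp
        have h2 : (2 * π) * ((j : ℝ) * n) = (2 * π) * k := by rw [← h1]; ring
        exact mul_left_cancel₀ (by positivity) h2
      have hjz : (j : ℤ) * n = k := by exact_mod_cast hj'
      have hdvd : (n : ℤ) ∣ (k : ℤ) := ⟨j, by rw [← hjz]; ring⟩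
      have hdvd' : n ∣ k := Int.natCast_dvd_natCast.mp hdvd
      exact absurd (Nat.le_of_dvd (by omega) hdvd') (by omega)
    exact lt_of_le_of_ne (cos_le_one _) hne
  linarith

/-- The sine part of the comb vanishes: `Σ_{k=1}^{n−1} sin(2πkm/n)/(1 − cos(2πk/n)) = 0` (reflection `k ↦ n − k`). -/
theorem soloBlind_comb_sin_sum (n m : ℕ) :
    ∑ k ∈ Ico 1 n, sin (2 * π * k * m / n) / (1 - cos (2 * π * k / n)) = 0 := by
  rcases Nat.lt_or_ge n 2 with hn | hn
  · have : Ico 1 n = ∅ := by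
      apply Finset.Ico_eq_empty_of_le; omega
    simp [this]
  have hn0 : (n : ℝ) ≠ 0 := by
    have : (0 : ℝ) < n := by exact_mod_cast (by omega : 0 < n)
    exact this.ne'
  set g : ℕ → ℝ := fun k => sin (2 * π * k * m / n) / (1 - cos (2 * π * k / n)) with hg
  -- reflection: g (n - k) = - g k for 1 ≤ k ≤ n - 1
  have hrefl : ∀ k ∈ Ico 1 n, g (n - k) = -g k := by
    intro k hk
    rw [Finset.mem_Ico] at hk
    have hcast : ((n - k : ℕ) : ℝ) = (n : ℝ) - k := by
      rw [Nat.cast_sub (by omega)]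
    simp only [hg, hcast]
    have e1 : 2 * π * ((n : ℝ) - k) * m / n = -(2 * π * k * m / n) + (m : ℕ) * (2 * π) := by
      field_simp; ring
    have e2 : 2 * π * ((n : ℝ) - k) / n = -(2 * π * k / n) + (1 : ℕ) * (2 * π) := by
      push_cast; field_simp; ring
    rw [e1, e2, sin_add_nat_mul_two_pi, cos_add_nat_mul_two_pi, sin_neg, cos_neg]
    ring
  -- Σ_{Ico 1 n} g = Σ_{Ico 1 n} g ∘ (n - ·)
  have hsum : ∑ k ∈ Ico 1 n, g k = ∑ k ∈ Ico 1 n, g (n - k) := by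
    refine Finset.sum_nbij' (fun k => n - k) (fun k => n - k) ?_ ?_ ?_ ?_ ?_
    · intro k hk; rw [Finset.mem_Ico] at hk ⊢; omega
    · intro k hk; rw [Finset.mem_Ico] at hk ⊢; omega
    · intro k hk; rw [Finset.mem_Ico] at hk; show n - (n - k) = k; omega
    · intro k hk; rw [Finset.mem_Ico] at hk; show n - (n - k) = k; omega
    · intro k hk; rw [Finset.mem_Ico] at hk; show g k = g (n - (n - k)); congr 1; omega
  have hneg : ∑ k ∈ Ico 1 n, g (n - k) = -∑ k ∈ Ico 1 n, g k := by
    rw [← sum_neg_distrib]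
    exact sum_congr rfl hrefl
  have : ∑ k ∈ Ico 1 n, g k = 0 := by linarith
  simpa [hg] using this

/-- The Fejér-kernel / cycle-resistance identity: for `0 ≤ d ≤ n`,
`Σ_{k=1}^{n−1} (1 − cos(2πkd/n))/(1 − cos(2πk/n)) = d(n − d)`. -/
theorem soloBlind_comb_cos_sum (n d : ℕ) (hd : d ≤ n) :
    ∑ k ∈ Ico 1 n, (1 - cos (2 * π * k * d / n)) / (1 - cos (2 * π * k / n)) = d * ((n : ℝ) - d) := by
  rcases Nat.lt_or_ge n 2 with hn | hn
  · -- n = 0 or 1: empty sum, and d(n-d) = 0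
    have : Ico 1 n = ∅ := by apply Finset.Ico_eq_empty_of_le; omega
    simp only [this, sum_empty]
    interval_cases n <;> interval_cases d <;> simp
  have hnpos : 0 < n := by omega
  have hn0 : (n : ℝ) ≠ 0 := by
    have : (0 : ℝ) < n := by exact_mod_cast hnpos
    exact this.ne'
  -- S d := the sum; second-difference recursion
  set S : ℕ → ℝ := fun d => ∑ k ∈ Ico 1 n, (1 - cos (2 * π * k * d / n)) / (1 - cos (2 * π * k / n)) with hS
  have hS0 : S 0 = 0 := by
    simp only [hS]
    refine sum_eq_zero fun k _ => ?_
    simp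
  have hS1 : S 1 = (n : ℝ) - 1 := by
    simp only [hS]
    have : ∀ k ∈ Ico 1 n, (1 - cos (2 * π * k * (1 : ℕ) / n)) / (1 - cos (2 * π * k / n)) = 1 := by
      intro k hk
      rw [Finset.mem_Ico] at hk
      have hpos := soloBlind_one_sub_cos_comb_pos n k hk.1 hk.2
      rw [Nat.cast_one, mul_one]
      exact div_self hpos.ne'
    rw [sum_congr rfl this]
    simp only [sum_const, Nat.card_Ico, nsmul_eq_mul, mul_one]
    rw [Nat.cast_sub (by omega)]
    simp
  have hrec : ∀ e : ℕ, 1 ≤ e → e + 1 ≤ n → S (e + 1) = 2 * S e - S (e - 1) - 2 := by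
    intro e he1 hen
    -- second difference termwise = 2 cos(2π k e / n)
    have hterm : ∀ k ∈ Ico 1 n,
        (1 - cos (2 * π * k * ((e + 1 : ℕ) : ℝ) / n)) / (1 - cos (2 * π * k / n))
          = 2 * ((1 - cos (2 * π * k * e / n)) / (1 - cos (2 * π * k / n)))
            - (1 - cos (2 * π * k * ((e - 1 : ℕ) : ℝ) / n)) / (1 - cos (2 * π * k / n))
            + 2 * cos (2 * π * k * e / n) := by
      intro k hk
      rw [Finset.mem_Ico] at hk
      have hpos := soloBlind_one_sub_cos_comb_pos n k hk.1 hk.2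
      have hc0 : 1 - cos (2 * π * k / n) ≠ 0 := hpos.ne'
      have hc : ((e - 1 : ℕ) : ℝ) = (e : ℝ) - 1 := by rw [Nat.cast_sub he1]; simp
      rw [hc]
      push_cast
      have ep : 2 * π * k * ((e : ℝ) + 1) / n = 2 * π * k * e / n + 2 * π * k / n := by ring
      have em : 2 * π * k * ((e : ℝ) - 1) / n = 2 * π * k * e / n - 2 * π * k / n := by ring
      rw [ep, em, cos_add, cos_sub, div_eq_iff hc0]
      field_simp
      ring
    -- Σ_{k=1}^{n-1} cos(2πke/n) = -1  (from Σ_{k=0}^{n-1} = 0, n ∤ e)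
    have hfull := soloBlind_sum_cos_comb_eq_zero n e hnpos (by
      intro hdvd; exact absurd (Nat.le_of_dvd (by omega) hdvd) (by omega))
    rw [Finset.range_eq_Ico, Finset.sum_eq_sum_Ico_succ_bot hnpos] at hfull
    simp only [zero_add, Nat.cast_zero, mul_zero, zero_mul, zero_div, cos_zero] at hfull
    have hm1 : ∑ k ∈ Ico 1 n, cos (2 * π * k * e / n) = -1 := by linarith
    simp only [hS]
    rw [sum_congr rfl hterm, sum_add_distrib, sum_sub_distrib, ← mul_sum, ← mul_sum, hm1]
    ring
  -- induction: P d := S d = d (n - d) ∧ S (d+1) = (d+1)(n-d-1), for d + 1 ≤ n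
  have main : ∀ d : ℕ, d + 1 ≤ n → S d = d * ((n : ℝ) - d) ∧ S (d + 1) = (d + 1 : ℕ) * ((n : ℝ) - (d + 1 : ℕ)) := by
    intro d
    induction d with
    | zero =>
      intro _
      refine ⟨by rw [hS0]; simp, ?_⟩
      show S 1 = ((0 + 1 : ℕ) : ℝ) * ((n : ℝ) - ((0 + 1 : ℕ) : ℝ))
      rw [hS1]; push_cast; ring
    | succ e ih =>
      intro hen
      have ih' := ih (by omega)
      refine ⟨ih'.2, ?_⟩
      rw [hrec (e + 1) (by omega) hen]
      rw [ih'.2, show e + 1 - 1 = e from by omega, ih'.1]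
      push_cast; ring
  -- conclude for d ≤ n
  rcases Nat.eq_or_lt_of_le hd with h | h
  · -- d = n: use main (n-1)
    subst h
    have := (main (d - 1) (by omega)).2
    rw [show d - 1 + 1 = d from by omega] at this
    simpa [hS] using this
  · have := (main d (by omega)).1
    simpa [hS] using this

/-- COMB IDENTITY (LEMMA Ψ* as an identity).  For a real trigonometric polynomial
`T(x) = Σ_{m=0}^{n} (a_m cos(mx) + b_m sin(mx))` of degree `≤ n`:
`Σ_{m=0}^{n} (n·m − m²) a_m = Σ_{k=1}^{n−1} (T(0) − T(2πk/n))/(1 − cos(2πk/n))`.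
The left side is `T″(0) + n·(T̃)′(0)`. -/
theorem soloBlind_psiStar_comb_identity (n : ℕ) (a b : ℕ → ℝ) (T : ℝ → ℝ)
    (hT : ∀ x, T x = ∑ m ∈ range (n + 1), (a m * cos (m * x) + b m * sin (m * x))) :
    ∑ m ∈ range (n + 1), ((n : ℝ) * m - (m : ℝ) ^ 2) * a m
      = ∑ k ∈ Ico 1 n, (T 0 - T (2 * π * k / n)) / (1 - cos (2 * π * k / n)) := by
  -- expand T(0) - T(2πk/n) termwise
  have hdiff : ∀ k : ℕ, T 0 - T (2 * π * k / n)
      = ∑ m ∈ range (n + 1), (a m * (1 - cos (2 * π * k * m / n)) - b m * sin (2 * π * k * m / n)) := by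
    intro k
    rw [hT, hT, ← sum_sub_distrib]
    refine sum_congr rfl fun m _ => ?_
    have e : (m : ℝ) * (2 * π * k / n) = 2 * π * k * m / n := by ring
    rw [e]
    simp only [mul_zero, cos_zero, sin_zero, mul_one, add_zero]
    ring
  simp_rw [hdiff, sum_div]
  rw [sum_comm]
  refine sum_congr rfl fun m hm => ?_
  rw [Finset.mem_range] at hm
  have hsplit : ∀ k : ℕ, (a m * (1 - cos (2 * π * k * m / n)) - b m * sin (2 * π * k * m / n))
        / (1 - cos (2 * π * k / n))
      = a m * ((1 - cos (2 * π * k * m / n)) / (1 - cos (2 * π * k / n)))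
        - b m * (sin (2 * π * k * m / n) / (1 - cos (2 * π * k / n))) := by
    intro k; ring
  simp_rw [hsplit]
  rw [sum_sub_distrib, ← mul_sum, ← mul_sum, soloBlind_comb_cos_sum n m (by omega),
    soloBlind_comb_sin_sum n m]
  ring

/-- LEMMA Ψ* (full statement, kernel form).  If `0` is a global maximum of the real trigonometric polynomial
`T(x) = Σ_{m=0}^{n} (a_m cos(mx) + b_m sin(mx))`, then `T″(0) + n·(T̃)′(0) = Σ_m (n·m − m²) a_m ≥ 0`.
(For a maximum at `ω*` apply this to `x ↦ T(x + ω*)`, again of the same form.) -/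
theorem soloBlind_psiStar_nonneg (n : ℕ) (a b : ℕ → ℝ) (T : ℝ → ℝ)
    (hT : ∀ x, T x = ∑ m ∈ range (n + 1), (a m * cos (m * x) + b m * sin (m * x)))
    (hmax : ∀ x, T x ≤ T 0) :
    0 ≤ ∑ m ∈ range (n + 1), ((n : ℝ) * m - (m : ℝ) ^ 2) * a m := by
  rw [soloBlind_psiStar_comb_identity n a b T hT]
  refine sum_nonneg fun k hk => ?_
  rw [Finset.mem_Ico] at hk
  exact div_nonneg (by linarith [hmax (2 * π * k / n)]) (soloBlind_one_sub_cos_comb_pos n k hk.1 hk.2).le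

/-- Equality case of LEMMA Ψ*: at a global maximum, `T″(0) + n·(T̃)′(0) = 0` forces `T(2πk/n) = T(0)` for every
`1 ≤ k ≤ n − 1` (so `max T − T` vanishes on the whole comb; with degree `≤ n` this is `max T − T = c(1 − cos nx)`). -/
theorem soloBlind_psiStar_eq_zero_iff (n : ℕ) (a b : ℕ → ℝ) (T : ℝ → ℝ)
    (hT : ∀ x, T x = ∑ m ∈ range (n + 1), (a m * cos (m * x) + b m * sin (m * x)))
    (hmax : ∀ x, T x ≤ T 0) :
    ∑ m ∈ range (n + 1), ((n : ℝ) * m - (m : ℝ) ^ 2) * a m = 0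
      ↔ ∀ k ∈ Ico 1 n, T (2 * π * k / n) = T 0 := by
  rw [soloBlind_psiStar_comb_identity n a b T hT]
  have hnn : ∀ k ∈ Ico 1 n, 0 ≤ (T 0 - T (2 * π * k / n)) / (1 - cos (2 * π * k / n)) := by
    intro k hk
    rw [Finset.mem_Ico] at hk
    exact div_nonneg (by linarith [hmax (2 * π * k / n)]) (soloBlind_one_sub_cos_comb_pos n k hk.1 hk.2).le
  rw [sum_eq_zero_iff_of_nonneg hnn]
  refine ⟨fun h k hk => ?_, fun h k hk => ?_⟩
  · have hk' := hk
    rw [Finset.mem_Ico] at hk'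
    have hpos := soloBlind_one_sub_cos_comb_pos n k hk'.1 hk'.2
    have := h k hk
    rw [div_eq_zero_iff] at this
    rcases this with h0 | h0
    · linarith
    · exact absurd h0 hpos.ne'
  · rw [h k hk, sub_self, zero_div]

/-- The derivative of `T(x) = Σ (a_m cos(mx) + b_m sin(mx))`. -/
theorem soloBlind_trigPoly_hasDerivAt (n : ℕ) (a b : ℕ → ℝ) (x : ℝ) :
    HasDerivAt (fun y => ∑ m ∈ range (n + 1), (a m * cos (m * y) + b m * sin (m * y)))
      (∑ m ∈ range (n + 1), (-(a m * m * sin (m * x)) + b m * m * cos (m * x))) x := by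
  apply HasDerivAt.fun_sum
  intro m _
  have hlin : HasDerivAt (fun y : ℝ => (m : ℝ) * y) m x := by
    simpa using (hasDerivAt_id x).const_mul (m : ℝ)
  have hc : HasDerivAt (fun y : ℝ => cos (m * y)) (-sin (m * x) * m) x :=
    (hasDerivAt_cos (m * x)).comp x hlin
  have hs : HasDerivAt (fun y : ℝ => sin (m * y)) (cos (m * x) * m) x :=
    (hasDerivAt_sin (m * x)).comp x hlin
  have h2 : HasDerivAt (fun y => a m * cos (m * y) + b m * sin (m * y))
      (a m * (-sin (m * x) * m) + b m * (cos (m * x) * m)) x :=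
    (hc.const_mul (a m)).add (hs.const_mul (b m))
  exact h2.congr_deriv (by ring)

/-- The second derivative at `0`: `T″(0) = −Σ m² a_m`. -/
theorem soloBlind_trigPoly_second_deriv (n : ℕ) (a b : ℕ → ℝ) :
    HasDerivAt (fun x => ∑ m ∈ range (n + 1), (-(a m * m * sin (m * x)) + b m * m * cos (m * x)))
      (-(∑ m ∈ range (n + 1), (m : ℝ) ^ 2 * a m)) 0 := by
  have key : HasDerivAt (fun x => ∑ m ∈ range (n + 1), (-(a m * m * sin (m * x)) + b m * m * cos (m * x)))
      (∑ m ∈ range (n + 1), (-(a m * m * (cos (m * (0 : ℝ)) * m)) + b m * m * (-sin (m * (0 : ℝ)) * m))) 0 := by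
    apply HasDerivAt.fun_sum
    intro m _
    have hlin : HasDerivAt (fun y : ℝ => (m : ℝ) * y) m 0 := by
      simpa using (hasDerivAt_id (0 : ℝ)).const_mul (m : ℝ)
    have hc : HasDerivAt (fun y : ℝ => cos (m * y)) (-sin (m * (0 : ℝ)) * m) 0 :=
      (hasDerivAt_cos (m * (0 : ℝ))).comp (0 : ℝ) hlin
    have hs : HasDerivAt (fun y : ℝ => sin (m * y)) (cos (m * (0 : ℝ)) * m) 0 :=
      (hasDerivAt_sin (m * (0 : ℝ))).comp (0 : ℝ) hlin
    exact ((hs.const_mul (a m * m)).neg).add (hc.const_mul (b m * m))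
  convert key using 1
  rw [← sum_neg_distrib]
  refine sum_congr rfl fun m _ => ?_
  simp; ring

/-- The conjugate polynomial `T̃(x) = Σ (a_m sin(mx) − b_m cos(mx))` has `(T̃)′(0) = Σ m a_m`. -/
theorem soloBlind_conjPoly_deriv (n : ℕ) (a b : ℕ → ℝ) :
    HasDerivAt (fun x => ∑ m ∈ range (n + 1), (a m * sin (m * x) - b m * cos (m * x)))
      (∑ m ∈ range (n + 1), (m : ℝ) * a m) 0 := by
  have key : HasDerivAt (fun x => ∑ m ∈ range (n + 1), (a m * sin (m * x) - b m * cos (m * x)))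
      (∑ m ∈ range (n + 1), (a m * (cos (m * (0 : ℝ)) * m) - b m * (-sin (m * (0 : ℝ)) * m))) 0 := by
    apply HasDerivAt.fun_sum
    intro m _
    have hlin : HasDerivAt (fun y : ℝ => (m : ℝ) * y) m 0 := by
      simpa using (hasDerivAt_id (0 : ℝ)).const_mul (m : ℝ)
    have hc : HasDerivAt (fun y : ℝ => cos (m * y)) (-sin (m * (0 : ℝ)) * m) 0 :=
      (hasDerivAt_cos (m * (0 : ℝ))).comp (0 : ℝ) hlin
    have hs : HasDerivAt (fun y : ℝ => sin (m * y)) (cos (m * (0 : ℝ)) * m) 0 :=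
      (hasDerivAt_sin (m * (0 : ℝ))).comp (0 : ℝ) hlin
    exact (hs.const_mul (a m)).sub (hc.const_mul (b m))
  convert key using 1
  refine sum_congr rfl fun m _ => ?_
  simp; ring

/-- LEMMA Ψ* in the shape used by THEOREM K: `T″(0) + n·(T̃)′(0) ≥ 0` at a global maximum at `0`, with the two
derivatives identified by `soloBlind_trigPoly_second_deriv` / `soloBlind_conjPoly_deriv`. -/
theorem soloBlind_psiStar (n : ℕ) (a b : ℕ → ℝ) (T : ℝ → ℝ)
    (hT : ∀ x, T x = ∑ m ∈ range (n + 1), (a m * cos (m * x) + b m * sin (m * x)))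
    (hmax : ∀ x, T x ≤ T 0) :
    0 ≤ (-(∑ m ∈ range (n + 1), (m : ℝ) ^ 2 * a m)) + n * ∑ m ∈ range (n + 1), (m : ℝ) * a m := by
  have h := soloBlind_psiStar_nonneg n a b T hT hmax
  have : (-(∑ m ∈ range (n + 1), (m : ℝ) ^ 2 * a m)) + n * ∑ m ∈ range (n + 1), (m : ℝ) * a m
      = ∑ m ∈ range (n + 1), ((n : ℝ) * m - (m : ℝ) ^ 2) * a m := by
    rw [mul_sum, ← sum_neg_distrib, ← sum_add_distrib]
    refine sum_congr rfl fun m _ => ?_; ring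
  rw [this]; exact h

end Summit.RiemannHypothesis.RiemannHypothesis.Theorems
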